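import Mathlib

/-!
# T5GammaFactor — the archimedean `Γ`-factor of (N4.3.P4)(α) and the Cartan block of (N4.3.P1)

Two more kernel checks for route/T5-N4-p5.md (owner p5), sub-step N4.3 of Tier 5:

* (N4.3.P4)(α): with the archimedean Lapid–Rallis factor equal to the Langlands factor
  (Lapid–Rallis 2005 §10 / Thm. 4 property 9, p5's R3.15), the tempered parameter of
  `π₀,τ′_j ⊗ χ_V` restricted to `ℂ^×` is a sum of two unitary characters
  `z ↦ (z/z̄)^{n_i/2} |z|^{2 i t_i}` (`n_i ∈ ℤ`, `t_i ∈ ℝ`), and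
  `L(s, π₀,τ′_j × χ_V) = ∏_{i=1,2} Γ_ℂ(s + |n_i|/2 + i t_i)`, `Γ_ℂ(s) := 2 (2π)^{-s} Γ(s)`
  (Tate's factor). Kernel form: the argument `1 + |n|/2 + i t` has real part `≥ 1 > 0`, so
  `Γ` is holomorphic (`DifferentiableAt`) and non-zero there (`Complex.Gamma_ne_zero_of_re_pos`,
  `Complex.differentiableAt_Gamma`), hence so is `Γ_ℂ`, hence so is the product of the two
  factors: `L(1, π₀,τ′_j × χ_V)` is FINITE and NON-ZERO — the two properties (N4.3.P4) uses.
* (N4.3.P1), the Cartan step of the CLAIM: for `g g* = k a² k⁻¹` with `a = diag(e^{t}, e^{−t})`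
  on a hyperbolic plane, `det((1 + g g*)/2) = det((1 + a²)/2) = ((1 + e^{2t})/2)((1 + e^{−2t})/2)
  = cosh² t` (`det_half_one_add_cartan`); the diagonalisation itself is not formalised.

Mathlib only. `Γ_ℂ` is `GammaC` below (a definition: review lane); nothing about `π₀`, the
L-parameter or Lapid–Rallis' normalisation is formalised — only the `Γ`-function facts.
-/

namespace Summit.Ventures.HodgeRepro2.T5GammaFactor

open Complex

/-- Tate's archimedean factor of a character of `ℂ^×`: `Γ_ℂ(s) = 2 (2π)^{-s} Γ(s)`. -/
noncomputable def GammaC (s : ℂ) : ℂ := 2 * (2 * Real.pi : ℂ) ^ (-s) * Complex.Gamma s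

/-- The argument of the `Γ`-factor of the unitary character `z ↦ (z/z̄)^{n/2}|z|^{2it}` at `s`:
`s + |n|/2 + i t`. -/
noncomputable def shiftedArg (s : ℂ) (n : ℤ) (t : ℝ) : ℂ := s + ((|n| : ℤ) : ℂ) / 2 + (t : ℂ) * I

/-- `Re(s + |n|/2 + it) = Re s + |n|/2`. -/
theorem re_shiftedArg (s : ℂ) (n : ℤ) (t : ℝ) :
    (shiftedArg s n t).re = s.re + ((|n| : ℤ) : ℝ) / 2 := by
  simp [shiftedArg]

/-- The real part of the argument is positive whenever `Re s > 0` (in particular at `s = 1`). -/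
theorem re_shiftedArg_pos {s : ℂ} (hs : 0 < s.re) (n : ℤ) (t : ℝ) :
    0 < (shiftedArg s n t).re := by
  rw [re_shiftedArg]
  have : (0 : ℝ) ≤ ((|n| : ℤ) : ℝ) := by exact_mod_cast abs_nonneg n
  linarith

/-- `Γ(s + |n|/2 + it) ≠ 0` for `Re s > 0`. -/
theorem Gamma_shiftedArg_ne_zero {s : ℂ} (hs : 0 < s.re) (n : ℤ) (t : ℝ) :
    Complex.Gamma (shiftedArg s n t) ≠ 0 :=
  Complex.Gamma_ne_zero_of_re_pos (re_shiftedArg_pos hs n t)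

/-- A complex number with positive real part is not a pole of `Γ` (no non-positive integer). -/
theorem ne_neg_natCast_of_re_pos {z : ℂ} (hz : 0 < z.re) (m : ℕ) : z ≠ -(m : ℂ) := by
  intro h
  have : z.re = -(m : ℝ) := by rw [h]; simp
  have hm : (0 : ℝ) ≤ m := Nat.cast_nonneg m
  linarith

/-- `Γ` is holomorphic at `s + |n|/2 + it` for `Re s > 0`. -/
theorem differentiableAt_Gamma_shiftedArg {s : ℂ} (hs : 0 < s.re) (n : ℤ) (t : ℝ) :
    DifferentiableAt ℂ Complex.Gamma (shiftedArg s n t) :=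
  Complex.differentiableAt_Gamma _ (ne_neg_natCast_of_re_pos (re_shiftedArg_pos hs n t))

/-- `(2π)^{-z} ≠ 0`. -/
theorem two_pi_cpow_ne_zero (z : ℂ) : (2 * Real.pi : ℂ) ^ (-z) ≠ 0 := by
  intro h
  rw [Complex.cpow_eq_zero_iff] at h
  have : (2 * Real.pi : ℂ) ≠ 0 := by
    exact_mod_cast (by positivity : (2 * Real.pi : ℝ) ≠ 0)
  exact this h.1

/-- **`Γ_ℂ(s + |n|/2 + it) ≠ 0` for `Re s > 0`** — one factor of `L(s, π₀,τ′_j × χ_V)`. -/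
theorem GammaC_shiftedArg_ne_zero {s : ℂ} (hs : 0 < s.re) (n : ℤ) (t : ℝ) :
    GammaC (shiftedArg s n t) ≠ 0 := by
  unfold GammaC
  exact mul_ne_zero (mul_ne_zero two_ne_zero (two_pi_cpow_ne_zero _))
    (Gamma_shiftedArg_ne_zero hs n t)

/-- `z ↦ Γ_ℂ(z)` is holomorphic at every `z` with `Re z > 0`. -/
theorem differentiableAt_GammaC {z : ℂ} (hz : 0 < z.re) : DifferentiableAt ℂ GammaC z := by
  unfold GammaC
  have h1 : DifferentiableAt ℂ (fun z : ℂ => (2 * Real.pi : ℂ) ^ (-z)) z := by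
    apply DifferentiableAt.const_cpow differentiableAt_id.neg
    left
    exact_mod_cast (by positivity : (2 * Real.pi : ℝ) ≠ 0)
  have h2 : DifferentiableAt ℂ Complex.Gamma z :=
    Complex.differentiableAt_Gamma _ (ne_neg_natCast_of_re_pos hz)
  exact (h1.const_mul 2).mul h2

/-- `s ↦ s + |n|/2 + it` is holomorphic. -/
theorem differentiableAt_shiftedArg (s : ℂ) (n : ℤ) (t : ℝ) :
    DifferentiableAt ℂ (fun s => shiftedArg s n t) s := by
  unfold shiftedArg
  fun_prop

/-- **`s ↦ Γ_ℂ(s + |n|/2 + it)` is holomorphic at every `s` with `Re s > 0`.** -/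
theorem differentiableAt_GammaC_shiftedArg {s : ℂ} (hs : 0 < s.re) (n : ℤ) (t : ℝ) :
    DifferentiableAt ℂ (fun s => GammaC (shiftedArg s n t)) s := by
  have h := (differentiableAt_GammaC (re_shiftedArg_pos hs n t)).comp s
    (differentiableAt_shiftedArg s n t)
  exact h

/-- **(N4.3.P4)(α) — the `L`-factor `∏_{i=1,2} Γ_ℂ(s + |n_i|/2 + i t_i)` is NON-ZERO at `s = 1`.** -/
theorem L_param_ne_zero_at_one (n₁ n₂ : ℤ) (t₁ t₂ : ℝ) :
    GammaC (shiftedArg 1 n₁ t₁) * GammaC (shiftedArg 1 n₂ t₂) ≠ 0 :=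
  mul_ne_zero (GammaC_shiftedArg_ne_zero (by simp) n₁ t₁) (GammaC_shiftedArg_ne_zero (by simp) n₂ t₂)

/-- **(N4.3.P4)(α) — the `L`-factor is HOLOMORPHIC (finite) at `s = 1`.** -/
theorem differentiableAt_L_param_at_one (n₁ n₂ : ℤ) (t₁ t₂ : ℝ) :
    DifferentiableAt ℂ (fun s => GammaC (shiftedArg s n₁ t₁) * GammaC (shiftedArg s n₂ t₂)) 1 :=
  (differentiableAt_GammaC_shiftedArg (by simp) n₁ t₁).mul
    (differentiableAt_GammaC_shiftedArg (by simp) n₂ t₂)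

/-- Both properties on the whole half-plane `Re s > 0` (so in particular in a neighbourhood of
`s = 1`): the `L`-factor is holomorphic and zero-free there. -/
theorem L_param_holomorphic_zero_free {s : ℂ} (hs : 0 < s.re) (n₁ n₂ : ℤ) (t₁ t₂ : ℝ) :
    DifferentiableAt ℂ (fun s => GammaC (shiftedArg s n₁ t₁) * GammaC (shiftedArg s n₂ t₂)) s ∧
      GammaC (shiftedArg s n₁ t₁) * GammaC (shiftedArg s n₂ t₂) ≠ 0 :=
  ⟨(differentiableAt_GammaC_shiftedArg hs n₁ t₁).mul (differentiableAt_GammaC_shiftedArg hs n₂ t₂),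
    mul_ne_zero (GammaC_shiftedArg_ne_zero hs n₁ t₁) (GammaC_shiftedArg_ne_zero hs n₂ t₂)⟩

/-- **The Cartan block of (N4.3.P1).** With `a² = diag(e^{2t}, e^{−2t})` on a hyperbolic plane,
`det((1 + a²)/2) = ((1 + e^{2t})/2)((1 + e^{−2t})/2) = cosh² t`. -/
theorem det_half_one_add_cartan (t : ℝ) :
    ((1 / 2 : ℝ) • (1 + Matrix.diagonal ![Real.exp (2 * t), Real.exp (-(2 * t))])).det
      = Real.cosh t ^ 2 := by
  have hdiag : (1 / 2 : ℝ) • (1 + Matrix.diagonal ![Real.exp (2 * t), Real.exp (-(2 * t))])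
      = Matrix.diagonal ![(1 + Real.exp (2 * t)) / 2, (1 + Real.exp (-(2 * t))) / 2] := by
    ext i j
    fin_cases i <;> fin_cases j <;> simp [Matrix.diagonal] <;> ring
  rw [hdiag, Matrix.det_diagonal, Fin.prod_univ_two]
  simp only [Matrix.cons_val_zero, Matrix.cons_val_one]
  have h1 : Real.exp (2 * t) = Real.exp t ^ 2 := by
    rw [← Real.exp_nat_mul]; push_cast; ring_nf
  have h2 : Real.exp (-(2 * t)) = (Real.exp t ^ 2)⁻¹ := by
    rw [Real.exp_neg, h1]
  rw [h1, h2, Real.cosh_eq, Real.exp_neg]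
  have hpos : Real.exp t ≠ 0 := (Real.exp_pos t).ne'
  field_simp
  ring

end Summit.Ventures.HodgeRepro2.T5GammaFactor
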